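import Mathlib.Topology.Semicontinuity.Hemicontinuity
import Mathlib.Topology.GDelta.Basic
import Mathlib.Topology.Bases
import Mathlib.Topology.Separation.Regular
import Mathlib.Topology.Baire.Lemmas
import HarnessLib

/-!
# Fort's theorem: an upper-hemicontinuous correspondence is lower hemicontinuous off a meagre set
# (M. K. Fort 1951, Thm 2; Kuratowski, *Topology* I, §43)

M. K. Fort Jr., *Points of continuity of semi-continuous functions*, Publ. Math. Debrecen **2** (1951)
100–102, Theorem 2: an upper semi-continuous (upper-hemicontinuous) set-valued map `Φ : X → Set Y` into a
separable metrisable space is lower semi-continuous at every point of a residual set.  We prove it in the form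
that needs no hypothesis on `X`: for `Y` regular and second countable, the set of points where `Φ` is NOT
lower hemicontinuous is meagre (`isMeagre_setOf_not_lowerHemicontinuousAt`); in a Baire space `X` the points
of lower hemicontinuity are therefore dense (`dense_setOf_lowerHemicontinuousAt`).  Mathlib has the
hemicontinuity vocabulary (`Mathlib/Topology/Semicontinuity/Hemicontinuity.lean`) but no theorem of this kind
(searched `LowerHemicontinuousAt`, `IsMeagre` in `Topology/Semicontinuity`, `Topology/Baire`, `Topology/GDelta`).

Proof (Kuratowski's, via a countable basis).  Let `𝔅` be a countable basis of `Y`.  For `V ∈ 𝔅` the lower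
inverse image `B V := {x | (Φ x ∩ closure V).Nonempty}` of the closed set `closure V` is closed, being the
complement of the open upper inverse image `{x | Φ x ⊆ (closure V)ᶜ}`
(`upperHemicontinuous_iff_isClosed_compl_preimage_Iic_compl`); hence its frontier `B V \ interior (B V)` is
closed and nowhere dense.  If `Φ` is not lower hemicontinuous at `x`, there are an open `U` and
`y ∈ Φ x ∩ U` such that `(Φ x' ∩ U).Nonempty` fails for `x'` arbitrarily close to `x`; regularity gives
`V ∈ 𝔅` with `y ∈ V`, `closure V ⊆ U` (`IsTopologicalBasis.exists_closure_subset`), whence `x ∈ B V` but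
`x ∉ interior (B V)`.  So the bad set lies in the countable union of the nowhere-dense frontiers.

Not here: the dual statement (a lower-hemicontinuous compact-valued map into a separable metrisable space is
upper hemicontinuous off a meagre set, Fort's Theorem 1), and the metric (Hausdorff-distance) formulations.

## References

* M. K. Fort Jr., *Points of continuity of semi-continuous functions*, Publ. Math. Debrecen 2 (1951), 100–102.
* K. Kuratowski, *Topology*, Vol. I, Academic Press 1966, §18 and §43.
-/

namespace Literature.Topology

open Set Filter TopologicalSpace _root_.Topology

/-- **Fort's theorem** (Fort 1951, Thm 2; Kuratowski, *Topology* I §43).  If `Φ : X → Set Y` is upper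
hemicontinuous and `Y` is regular and second countable, then the set of points at which `Φ` is not lower
hemicontinuous is meagre.  No hypothesis on `X`. [cite: Fort1951, Thm 2] -/
theorem isMeagre_setOf_not_lowerHemicontinuousAt {X Y : Type*} [TopologicalSpace X] [TopologicalSpace Y]
    [SecondCountableTopology Y] [RegularSpace Y] {Φ : X → Set Y} (hΦ : UpperHemicontinuous Φ) :
    IsMeagre {x | ¬ LowerHemicontinuousAt Φ x} := by
  -- the closed sets `B V`, `V` in the countable basis, and their nowhere-dense frontiers
  -- (`B V` is the complement of the open upper inverse image `{x | Φ x ⊆ (closure V)ᶜ}`)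
  have hB : ∀ V : Set Y, IsClosed {x | (Φ x ∩ closure V).Nonempty} := fun V => by
    have h : IsClosed (Φ ⁻¹' Iic (closure V)ᶜ)ᶜ :=
      upperHemicontinuous_iff_isClosed_compl_preimage_Iic_compl.mp hΦ (closure V) isClosed_closure
    convert h using 1
    ext x
    simp only [mem_setOf_eq, mem_compl_iff, mem_preimage, mem_Iic,
      subset_compl_iff_disjoint_right, not_disjoint_iff_nonempty_inter]
  have hfr : ∀ V : Set Y, IsMeagre (frontier {x | (Φ x ∩ closure V).Nonempty}) := fun V =>
    (isClosed_frontier.isNowhereDense_iff.mpr (interior_frontier (hB V))).isMeagre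
  have hM : IsMeagre (⋃ V ∈ countableBasis Y, frontier {x | (Φ x ∩ closure V).Nonempty}) :=
    isMeagre_biUnion (countable_countableBasis Y) fun V _ => hfr V
  refine hM.mono ?_
  intro x hx
  -- unpack the failure of lower hemicontinuity at `x`
  have hx' : ∃ U : Set Y, IsOpen U ∧ (Φ x ∩ U).Nonempty ∧ ¬ ∀ᶠ x' in 𝓝 x, (Φ x' ∩ U).Nonempty := by
    by_contra h
    refine hx (lowerHemicontinuousAt_iff.mpr fun U hU hne => ?_)
    by_contra h'
    exact h ⟨U, hU, hne, h'⟩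
  obtain ⟨U, hU, ⟨y, hyΦ, hyU⟩, hnot⟩ := hx'
  -- a basic open `V ∋ y` with `closure V ⊆ U` (regularity)
  obtain ⟨V, hVB, hyV, hVU⟩ := (isBasis_countableBasis Y).exists_closure_subset (hU.mem_nhds hyU)
  refine mem_iUnion₂.mpr ⟨V, hVB, ?_⟩
  rw [(hB V).frontier_eq]
  refine ⟨⟨y, hyΦ, subset_closure hyV⟩, fun hxint => hnot ?_⟩
  have hev : ∀ᶠ x' in 𝓝 x, x' ∈ {x | (Φ x ∩ closure V).Nonempty} := mem_interior_iff_mem_nhds.mp hxint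
  exact hev.mono fun x' hx' => Set.Nonempty.mono (inter_subset_inter_right (Φ x') hVU) hx'

/-- **Fort's theorem, Baire form** (Fort 1951, Thm 2): an upper-hemicontinuous correspondence from a Baire space
into a regular second-countable space is lower hemicontinuous at every point of a dense (indeed residual) set.
[cite: Fort1951, Thm 2] -/
theorem dense_setOf_lowerHemicontinuousAt {X Y : Type*} [TopologicalSpace X] [BaireSpace X]
    [TopologicalSpace Y] [SecondCountableTopology Y] [RegularSpace Y] {Φ : X → Set Y}
    (hΦ : UpperHemicontinuous Φ) : Dense {x | LowerHemicontinuousAt Φ x} := by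
  have h : IsMeagre {x | ¬ LowerHemicontinuousAt Φ x} := isMeagre_setOf_not_lowerHemicontinuousAt hΦ
  rw [IsMeagre, compl_setOf] at h
  simpa only [not_not] using dense_of_mem_residual h

end Literature.Topology
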